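import Literature.AnabelianGeometry.EtaleTheta.Discharge.Sec1CompatOfSetting
import HarnessLib

/-!
# [EtTh] §1: `Ker(Π^tp_X ↠ (Π^tp_X)^ell) ⊆ Π^tp_{Y₂}` from the root axioms — the level-`2` case of the
# containment "`Y_N → Y` is cut out inside `(Π^tp_Y)^ell`" (p. 13)

Mochizuki, *The étale theta function …*, Publ. RIMS **45** (2009), §1, PRIMS PDF pp. 12–13, 17
(printed 238–239, 243) [cite: MochizukiEtTh2009, §1 p.13]. Layer L2 of the abc-iut cell, seat
abc-iut-L2-t1 (root owner). PROOF-ONLY companion (no `def`) of the root `Setting.lean`.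

p. 13: "`Y_N → Y` … the open immersion `G_{K_N} ↪ (Π^tp_Y)^ell/N·(Δ^tp_Y)^ell` the image of which …
determines a Galois covering". The root interface `ThetaSetting` records `Π^tp_{Y_N}` only through its
image `G_{K_N}` in `G_{ℚ_p}` and the index `[Δ^tp_Y : Δ^tp_{Y_N}] = N`; abc-iut-L2-t8 isolated the
missing consequence `Ker(Π^tp_X ↠ (Π^tp_X)^ell) ∩ Π^tp_Y ⊆ Π^tp_{Y_N}` as the hypothesis
`Sec2Hyps.ker_toEll_le_GtpYN` (not derivable for general `N`: the root does not say that
`Δ^tp_X/Δ^tp_{Y_N}` is abelian). THIS FILE PROVES THE CASE `N = 2` from the root axioms alone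
(`ThetaSetting.ker_toEll_le_GtpYN_two`), which is the case the §1 cohomology needs (`Π^tp_Ÿ = Π^tp_{Y₂}
∩ aug⁻¹ G_K̈`, p. 17): a normal subgroup of ORDER `2` is central, so `Δ^tp_X/Δ^tp_{Y₂}` — an extension
of `Z ≅ ℤ` by `Δ^tp_Y/Δ^tp_{Y₂}` (order `2`) — is abelian (`commutator_mem_GtpYN_two`); then the closed
commutator subgroup `[Δ_X, Δ_X]⁻` of the profinite completion is controlled through ONE open normal
subgroup of finite index `U ⊇ Π^tp_{Y₂}` of `Π^tp_X` with `U ∩ Π^tp_Y = Π^tp_{Y₂}` (built from a power of a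
lift of `1 ∈ Z` centralising the finite group `Π^tp_Y/Π^tp_{Y₂}`; `[Π^tp_Y : Π^tp_{Y₂}] = 2·[K̈ : K]` is
finite by `relIndex_deltaYN` and `SettingGaloisFacts`) and the profinite-completion axiom
`IsProfiniteCompletion.comap_surjective`, exactly as in abc-iut-L2-t8's `ker_toEll_le_GtpY`.
CONSEQUENCE (with `Discharge/Sec1CompatOfSetting.lean`): **the §1 hypothesis structure `Compat` HOLDS
for EVERY `ThetaSetting`** — `ThetaSetting.compat : D.Compat`; every `(hC : D.Compat)` binder of the §1
statements (Props. 1.4 (iii), 1.5, Thm. 1.6 (iii), Def. 1.9, Thm. 1.10) and of the §2 adapter can be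
supplied by `D.compat`. HONEST FRAMING: structural consequence of the root data; nothing of [EtTh] is
asserted; no side is taken on any disputed claim.
-/

namespace Literature.AnabelianGeometry.EtaleTheta

open Literature.AnabelianGeometry.SemiGraphs
open _root_.Topology

namespace ThetaSetting

variable {p : ℕ} [Fact p.Prime] (D : ThetaSetting p)

/-! ### `Δ^tp_X/Δ^tp_{Y₂}` is abelian -/

/-- `Δ^tp_{Y₂} = Π^tp_{Y₂} ∩ Δ^tp_X` is normal in `Π^tp_X`. [cite: MochizukiEtTh2009, §1 p.13] -/
theorem dtpYN_normal (N : ℕ+) : (D.DtpYN N).Normal := by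
  haveI := D.GtpYN_normal N
  haveI : D.DeltaTemp.Normal := inferInstanceAs D.aug.toMonoidHom.ker.Normal
  exact Subgroup.normal_inf_normal _ _

/-- `Δ^tp_Y = Π^tp_Y ∩ Δ^tp_X` is normal in `Π^tp_X`. [cite: MochizukiEtTh2009, §1 p.12] -/
theorem dtpY_normal : D.DtpY.Normal := by
  haveI : D.GtpY.Normal := inferInstanceAs D.toZ.ker.Normal
  haveI : D.DeltaTemp.Normal := inferInstanceAs D.aug.toMonoidHom.ker.Normal
  exact Subgroup.normal_inf_normal _ _

/-- **A normal subgroup of order `2` is central**: since `[Δ^tp_Y : Δ^tp_{Y₂}] = 2`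
("`Δ^tp_Y/Δ^tp_{Y_N} ≅ ℤ/Nℤ(1)`", p. 16), every `c ∈ Δ^tp_Y` commutes with every element of `Π^tp_X`
modulo `Δ^tp_{Y₂}`. [cite: MochizukiEtTh2009, §1 p.16] -/
theorem conj_mul_inv_mem_dtpYN_two (a : D.PiTemp) {c : D.PiTemp} (hc : c ∈ D.DtpY) :
    a * c * a⁻¹ * c⁻¹ ∈ D.DtpYN 2 := by
  haveI := D.dtpYN_normal 2
  haveI := D.dtpY_normal
  have h2 : (D.DtpYN 2).relIndex D.DtpY = 2 := by exact_mod_cast D.relIndex_deltaYN 2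
  obtain ⟨g, -, hg⟩ := Subgroup.relIndex_eq_two_iff.1 h2
  have hc' : a * c * a⁻¹ ∈ D.DtpY := (inferInstance : D.DtpY.Normal).conj_mem c hc a
  by_cases hc2 : c ∈ D.DtpYN 2
  · exact (D.DtpYN 2).mul_mem ((inferInstance : (D.DtpYN 2).Normal).conj_mem c hc2 a)
      ((D.DtpYN 2).inv_mem hc2)
  · have hc'2 : a * c * a⁻¹ ∉ D.DtpYN 2 := by
      intro h
      apply hc2
      have := (inferInstance : (D.DtpYN 2).Normal).conj_mem _ h a⁻¹
      simpa [mul_assoc] using this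
    have h1 : c * g ∈ D.DtpYN 2 := by
      rcases hg c hc with ⟨h, -⟩ | ⟨h, -⟩
      · exact h
      · exact absurd h hc2
    have h2' : a * c * a⁻¹ * g ∈ D.DtpYN 2 := by
      rcases hg _ hc' with ⟨h, -⟩ | ⟨h, -⟩
      · exact h
      · exact absurd h hc'2
    have : a * c * a⁻¹ * c⁻¹ = (a * c * a⁻¹ * g) * (c * g)⁻¹ := by group
    rw [this]
    exact (D.DtpYN 2).mul_mem h2' ((D.DtpYN 2).inv_mem h1)


/-- A lift to `Δ^tp_X` of the generator `1 ∈ Z` ("`Δ^tp_X/Δ^tp_Y ≅ Z`", pp. 16, 28).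
[cite: MochizukiEtTh2009, §1 p.16] -/
theorem exists_mem_deltaTemp_toZ_eq_one :
    ∃ z : D.PiTemp, z ∈ D.DeltaTemp ∧ D.toZ z = Multiplicative.ofAdd 1 := by
  obtain ⟨⟨z, hz⟩, hz1⟩ := D.toZ_delta_surjective (Multiplicative.ofAdd 1)
  exact ⟨z, hz, hz1⟩

/-- **`Δ^tp_X/Δ^tp_{Y₂}` is abelian**: for `a, b ∈ Δ^tp_X`, `[a, b] ∈ Δ^tp_{Y₂}` — `Δ^tp_X/Δ^tp_{Y₂}` is an
extension of `Δ^tp_X/Δ^tp_Y ≅ Z` (p. 16) by the order-`2` (hence central) group `Δ^tp_Y/Δ^tp_{Y₂}`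
(p. 16, `N = 2`). [cite: MochizukiEtTh2009, §1 p.16] -/
theorem commutator_mem_dtpYN_two {a b : D.PiTemp} (ha : a ∈ D.DeltaTemp) (hb : b ∈ D.DeltaTemp) :
    a * b * a⁻¹ * b⁻¹ ∈ D.DtpYN 2 := by
  haveI := D.dtpYN_normal 2
  obtain ⟨z, hzΔ, hz1⟩ := D.exists_mem_deltaTemp_toZ_eq_one
  -- decompose `a = c z^i`, `b = c' z^j` with `c, c' ∈ Δ^tp_Y`
  have hdec : ∀ x ∈ D.DeltaTemp, ∃ (c : D.PiTemp) (i : ℤ), c ∈ D.DtpY ∧ x = c * z ^ i := by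
    intro x hx
    refine ⟨x * z ^ (-(Multiplicative.toAdd (D.toZ x))), Multiplicative.toAdd (D.toZ x), ⟨?_, ?_⟩, ?_⟩
    · change x * z ^ (-(Multiplicative.toAdd (D.toZ x))) ∈ D.toZ.ker
      rw [MonoidHom.mem_ker, map_mul, map_zpow, hz1]
      apply Multiplicative.toAdd.injective
      rw [toAdd_mul, toAdd_zpow, toAdd_ofAdd, toAdd_one, smul_eq_mul, mul_one, add_neg_cancel]
    · exact D.DeltaTemp.mul_mem hx (D.DeltaTemp.zpow_mem hzΔ _)
    · rw [mul_assoc, ← zpow_add, neg_add_cancel, zpow_zero, mul_one]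
  -- in the quotient by `Δ^tp_{Y₂}` the image of `Δ^tp_Y` is central
  have hcent : ∀ (x : D.PiTemp) {c : D.PiTemp}, c ∈ D.DtpY →
      (x : D.PiTemp ⧸ D.DtpYN 2) * c = c * x := by
    intro x c hc
    have h1 : ((x * c * x⁻¹ * c⁻¹ : D.PiTemp) : D.PiTemp ⧸ D.DtpYN 2) = 1 :=
      (QuotientGroup.eq_one_iff _).2 (D.conj_mul_inv_mem_dtpYN_two x hc)
    simp only [QuotientGroup.mk_mul, QuotientGroup.mk_inv] at h1
    rw [mul_inv_eq_one, mul_inv_eq_iff_eq_mul] at h1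
    exact h1
  obtain ⟨c, i, hc, rfl⟩ := hdec a ha
  obtain ⟨c', j, hc', rfl⟩ := hdec b hb
  have h1 := hcent (z ^ i) hc'
  have h2 := hcent (z ^ j) hc
  have h3 := hcent c hc'
  rw [QuotientGroup.mk_zpow] at h1 h2
  rw [← QuotientGroup.eq_one_iff]
  simp only [QuotientGroup.mk_mul, QuotientGroup.mk_inv, QuotientGroup.mk_zpow]
  rw [mul_inv_eq_one, mul_inv_eq_iff_eq_mul]
  calc (c : D.PiTemp ⧸ D.DtpYN 2) * (z : D.PiTemp ⧸ D.DtpYN 2) ^ i *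
        ((c' : D.PiTemp ⧸ D.DtpYN 2) * (z : D.PiTemp ⧸ D.DtpYN 2) ^ j)
      = c * ((z : D.PiTemp ⧸ D.DtpYN 2) ^ i * c') * (z : D.PiTemp ⧸ D.DtpYN 2) ^ j := by
        simp only [mul_assoc]
    _ = c * (c' * (z : D.PiTemp ⧸ D.DtpYN 2) ^ i) * (z : D.PiTemp ⧸ D.DtpYN 2) ^ j := by rw [h1]
    _ = (c * c') * ((z : D.PiTemp ⧸ D.DtpYN 2) ^ i * (z : D.PiTemp ⧸ D.DtpYN 2) ^ j) := by
        simp only [mul_assoc]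
    _ = (c' * c) * ((z : D.PiTemp ⧸ D.DtpYN 2) ^ j * (z : D.PiTemp ⧸ D.DtpYN 2) ^ i) := by
        rw [h3, zpow_mul_comm]
    _ = c' * (c * (z : D.PiTemp ⧸ D.DtpYN 2) ^ j) * (z : D.PiTemp ⧸ D.DtpYN 2) ^ i := by
        simp only [mul_assoc]
    _ = c' * ((z : D.PiTemp ⧸ D.DtpYN 2) ^ j * c) * (z : D.PiTemp ⧸ D.DtpYN 2) ^ i := by rw [h2]
    _ = (c' : D.PiTemp ⧸ D.DtpYN 2) * (z : D.PiTemp ⧸ D.DtpYN 2) ^ j *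
        ((c : D.PiTemp ⧸ D.DtpYN 2) * (z : D.PiTemp ⧸ D.DtpYN 2) ^ i) := by
        simp only [mul_assoc]

/-- Hence `[Δ^tp_X, Δ^tp_X] ⊆ Π^tp_{Y₂}` (p. 13, `N = 2`). [cite: MochizukiEtTh2009, §1 p.13] -/
theorem commutator_mem_GtpYN_two {a b : D.PiTemp} (ha : a ∈ D.DeltaTemp) (hb : b ∈ D.DeltaTemp) :
    a * b * a⁻¹ * b⁻¹ ∈ D.GtpYN 2 :=
  (Subgroup.mem_inf.1 (D.commutator_mem_dtpYN_two ha hb)).1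


/-! ### `[Π^tp_Y : Π^tp_{Y₂}]` is finite -/

/-- `Π^tp_Y ∩ aug⁻¹(G_{K₂}) = Π^tp_{Y₂} · Δ^tp_Y` (the image of `Π^tp_{Y₂}` in `G_{ℚ_p}` is `G_{K₂}`, p. 13).
[cite: MochizukiEtTh2009, §1 p.13] -/
theorem GtpY_inf_comap_GKN_two :
    D.GtpY ⊓ (D.GKN 2).comap D.aug.toMonoidHom = D.GtpYN 2 ⊔ D.DtpY := by
  haveI := D.GtpYN_normal 2
  apply le_antisymm
  · intro m hm'
    obtain ⟨hmY, hmK⟩ := Subgroup.mem_inf.1 hm'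
    rw [Subgroup.mem_comap] at hmK
    have hm : D.aug.toMonoidHom m ∈ (D.GtpYN 2).map D.aug.toMonoidHom := by
      rw [D.map_aug_GtpYN]; exact hmK
    obtain ⟨y₂, hy₂, hy₂m⟩ := hm
    have hk : y₂⁻¹ * m ∈ D.DtpY := by
      refine Subgroup.mem_inf.2 ⟨D.GtpY.mul_mem (D.GtpY.inv_mem (D.GtpYN_le 2 hy₂)) hmY, ?_⟩
      change y₂⁻¹ * m ∈ D.aug.toMonoidHom.ker
      rw [MonoidHom.mem_ker, map_mul, map_inv, hy₂m, inv_mul_cancel]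
    have : m = y₂ * (y₂⁻¹ * m) := by group
    rw [this]
    exact Subgroup.mul_mem _ (Subgroup.mem_sup_left hy₂) (Subgroup.mem_sup_right hk)
  · refine sup_le (fun y hy => Subgroup.mem_inf.2 ⟨D.GtpYN_le 2 hy, ?_⟩)
      (fun y hy => Subgroup.mem_inf.2 ⟨(Subgroup.mem_inf.1 hy).1, ?_⟩)
    · rw [Subgroup.mem_comap]
      have : D.aug.toMonoidHom y ∈ (D.GtpYN 2).map D.aug.toMonoidHom := ⟨y, hy, rfl⟩
      rw [D.map_aug_GtpYN] at this
      exact this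
    · rw [Subgroup.mem_comap]
      have h1 : D.aug.toMonoidHom y = 1 := (Subgroup.mem_inf.1 hy).2
      rw [h1]
      exact one_mem _

/-- The image of `Π^tp_Y` in `G_{ℚ_p}` is `G_K` (`Y₁ = Y`, `K₁ = K`, pp. 13–14).
[cite: MochizukiEtTh2009, §1 p.14] -/
theorem map_aug_GtpY : D.GtpY.map D.aug.toMonoidHom = D.GK := by
  change D.toZ.ker.map D.aug.toMonoidHom = D.GK
  rw [← D.GtpYN_one, D.map_aug_GtpYN]
  exact D.GKN_one

/-- **`[Π^tp_Y : Π^tp_{Y₂}] = 2 · [G_K : G_{K₂}]` is finite (nonzero)** — from `[Δ^tp_Y : Δ^tp_{Y₂}] = 2`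
(p. 16) and `[K̈ : K] ≤ 2` (`K̈ = K₂ = K(q_X^{1/2})`, p. 17). [cite: MochizukiEtTh2009, §1 p.17] -/
theorem relIndex_GtpYN_two_GtpY_ne_zero : (D.GtpYN 2).relIndex D.GtpY ≠ 0 := by
  haveI := D.GtpYN_normal 2
  have hY₂M : D.GtpYN 2 ≤ D.GtpY ⊓ (D.GKN 2).comap D.aug.toMonoidHom := by
    rw [D.GtpY_inf_comap_GKN_two]; exact le_sup_left
  have hMY : D.GtpY ⊓ (D.GKN 2).comap D.aug.toMonoidHom ≤ D.GtpY := inf_le_left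
  rw [← Subgroup.relIndex_mul_relIndex _ _ _ hY₂M hMY]
  apply mul_ne_zero
  · rw [D.GtpY_inf_comap_GKN_two, Subgroup.relIndex_sup_left, ← Subgroup.inf_relIndex_right]
    have hle : D.GtpYN 2 ≤ D.GtpY := D.GtpYN_le 2
    have : D.GtpYN 2 ⊓ D.DtpY = D.DtpYN 2 := by
      change D.GtpYN 2 ⊓ (D.GtpY ⊓ D.DeltaTemp) = D.GtpYN 2 ⊓ D.DeltaTemp
      rw [← inf_assoc, inf_eq_left.2 hle]
    rw [this]
    have h2 : (D.DtpYN 2).relIndex D.DtpY = 2 := by exact_mod_cast D.relIndex_deltaYN 2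
    rw [h2]
    norm_num
  · rw [Subgroup.inf_relIndex_left, Subgroup.relIndex_comap, D.map_aug_GtpY]
    exact D.relIndex_GKdd_ne_zero


/-! ### The main containment -/

/-- **`Ker(Π^tp_X ↠ (Π^tp_X)^ell) ⊆ Π^tp_{Y₂}`** — the `N = 2` case of "`Y_N → Y` is cut out inside
`(Π^tp_Y)^ell/N·(Δ^tp_Y)^ell`" (p. 13), PROVED from the root axioms: `[Δ^tp_X, Δ^tp_X] ⊆ Π^tp_{Y₂}`
(`commutator_mem_GtpYN_two`) and the closed commutator subgroup `[Δ_X, Δ_X]⁻ ⊆ Π_X` is caught by the open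
normal subgroup of `Π_X` attached (`IsProfiniteCompletion.comap_surjective`) to an open normal subgroup
`U ⊇ Π^tp_{Y₂}` of `Π^tp_X` of finite index with `U ∩ Π^tp_Y = Π^tp_{Y₂}`.
[cite: MochizukiEtTh2009, §1 p.13] -/
theorem ker_toEll_le_GtpYN_two : (D.thetaToEll.comp D.toTheta).ker ≤ D.GtpYN 2 := by
  classical
  intro x hx
  have hxY : x ∈ D.GtpY := D.ker_toEll_le_GtpY hx
  rw [D.ker_toEll, Subgroup.mem_comap] at hx
  haveI hY₂n : (D.GtpYN 2).Normal := D.GtpYN_normal 2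
  haveI hYn : D.GtpY.Normal := inferInstanceAs D.toZ.ker.Normal
  -- the quotient `E := Π^tp_X / Π^tp_{Y₂}`
  let mk : D.PiTemp →* D.PiTemp ⧸ D.GtpYN 2 := QuotientGroup.mk' (D.GtpYN 2)
  have hmk_surj : Function.Surjective mk := QuotientGroup.mk'_surjective _
  have hmk_ker : mk.ker = D.GtpYN 2 := QuotientGroup.ker_mk' _
  have hmk_eq_one : ∀ g : D.PiTemp, mk g = 1 ↔ g ∈ D.GtpYN 2 := fun g => QuotientGroup.eq_one_iff g
  -- `F := Π^tp_Y / Π^tp_{Y₂}`, a finite normal subgroup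
  let F : Subgroup (D.PiTemp ⧸ D.GtpYN 2) := D.GtpY.map mk
  haveI hFn : F.Normal := hYn.map mk hmk_surj
  haveI hFfin : Finite F := by
    apply Nat.finite_of_card_ne_zero
    rw [← Subgroup.relIndex_ker (K := D.GtpY) (f := mk), hmk_ker]
    exact D.relIndex_GtpYN_two_GtpY_ne_zero
  -- `τ : E → Z` induced by `toZ`; it kills `F`
  let τ : D.PiTemp ⧸ D.GtpYN 2 →* Multiplicative ℤ :=
    QuotientGroup.lift (D.GtpYN 2) D.toZ (D.GtpYN_le 2)
  have hτ : ∀ g : D.PiTemp, τ (mk g) = D.toZ g := fun g => rfl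
  have hτF : ∀ y ∈ F, τ y = 1 := by
    rintro _ ⟨g, hg, rfl⟩
    rw [hτ]
    exact hg
  -- a lift `t` of `1 ∈ Z`; every element of `E` is `y * t̄ ^ i` with `y ∈ F`
  obtain ⟨t, ht⟩ := D.toZ_surjective (Multiplicative.ofAdd 1)
  have hdecE : ∀ e : D.PiTemp ⧸ D.GtpYN 2,
      ∃ (y : D.PiTemp ⧸ D.GtpYN 2) (i : ℤ), y ∈ F ∧ e = y * mk t ^ i := by
    intro e
    obtain ⟨g, rfl⟩ := hmk_surj e
    refine ⟨mk (g * t ^ (-(Multiplicative.toAdd (D.toZ g)))), Multiplicative.toAdd (D.toZ g),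
      ⟨g * t ^ (-(Multiplicative.toAdd (D.toZ g))), ?_, rfl⟩, ?_⟩
    · change g * t ^ (-(Multiplicative.toAdd (D.toZ g))) ∈ D.toZ.ker
      rw [MonoidHom.mem_ker, map_mul, map_zpow, ht]
      apply Multiplicative.toAdd.injective
      rw [toAdd_mul, toAdd_zpow, toAdd_ofAdd, toAdd_one, smul_eq_mul, mul_one, add_neg_cancel]
    · rw [← map_zpow, ← map_mul, mul_assoc, ← zpow_add, neg_add_cancel, zpow_zero, mul_one]
  -- a nonzero power `t̄ ^ k` centralising the finite normal subgroup `F` (pigeonhole)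
  obtain ⟨k, hk0, hkF⟩ : ∃ k : ℤ, k ≠ 0 ∧ ∀ y ∈ F, mk t ^ k * y = y * mk t ^ k := by
    let f : ℕ → (F → F) := fun n y =>
      ⟨mk t ^ (n : ℤ) * y * (mk t ^ (n : ℤ))⁻¹, hFn.conj_mem _ y.2 _⟩
    obtain ⟨n₁, n₂, hne, hfeq⟩ := Finite.exists_ne_map_eq_of_infinite f
    refine ⟨(n₂ : ℤ) - n₁, by omega, fun y hy => ?_⟩
    have hy' : mk t ^ (n₁ : ℤ) * y * (mk t ^ (n₁ : ℤ))⁻¹ =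
        mk t ^ (n₂ : ℤ) * y * (mk t ^ (n₂ : ℤ))⁻¹ := by
      have := congrArg (fun φ : F → F => ((φ ⟨y, hy⟩ : F) : D.PiTemp ⧸ D.GtpYN 2)) hfeq
      simpa [f] using this
    have key : (mk t ^ (n₂ : ℤ))⁻¹ * (mk t ^ (n₁ : ℤ) * y * (mk t ^ (n₁ : ℤ))⁻¹) * mk t ^ (n₂ : ℤ) =
        y := by
      rw [hy']; group
    calc mk t ^ ((n₂ : ℤ) - n₁) * y
        = mk t ^ ((n₂ : ℤ) - n₁) *
            ((mk t ^ (n₂ : ℤ))⁻¹ * (mk t ^ (n₁ : ℤ) * y * (mk t ^ (n₁ : ℤ))⁻¹) * mk t ^ (n₂ : ℤ)) := by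
          rw [key]
      _ = y * mk t ^ ((n₂ : ℤ) - n₁) := by group
  -- `t̄ ^ k` is central in `E`
  have hcentral : ∀ e : D.PiTemp ⧸ D.GtpYN 2, Commute e (mk t ^ k) := by
    intro e
    obtain ⟨y, i, hy, rfl⟩ := hdecE e
    change y * mk t ^ i * mk t ^ k = mk t ^ k * (y * mk t ^ i)
    rw [mul_assoc, ← zpow_add, add_comm, zpow_add, ← mul_assoc, ← hkF y hy, mul_assoc]
  -- `Z := ⟨t̄ ^ k⟩`: normal, meets `F` trivially, of finite index
  let Z : Subgroup (D.PiTemp ⧸ D.GtpYN 2) := Subgroup.zpowers (mk t ^ k)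
  haveI hZn : Z.Normal := by
    refine ⟨fun z hz e => ?_⟩
    obtain ⟨j, rfl⟩ := Subgroup.mem_zpowers_iff.1 hz
    rw [((hcentral e).zpow_right j).eq, mul_inv_cancel_right]
    exact hz
  have hZF : ∀ z ∈ Z, z ∈ F → z = 1 := by
    intro z hz hzF
    obtain ⟨j, rfl⟩ := Subgroup.mem_zpowers_iff.1 hz
    have h1 : τ ((mk t ^ k) ^ j) = 1 := hτF _ hzF
    rw [map_zpow, map_zpow, hτ, ht] at h1
    have h2 := congrArg Multiplicative.toAdd h1
    rw [toAdd_zpow, toAdd_zpow, toAdd_ofAdd, toAdd_one, smul_eq_mul, smul_eq_mul, mul_one] at h2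
    have hj : j = 0 := (mul_eq_zero.1 h2).resolve_right hk0
    rw [hj, zpow_zero]
  have hkpos : 0 < (k.natAbs : ℤ) := by exact_mod_cast Int.natAbs_pos.2 hk0
  haveI : Finite ((D.PiTemp ⧸ D.GtpYN 2) ⧸ Z) := by
    refine Finite.of_surjective
      (fun q : F × Fin k.natAbs =>
        (QuotientGroup.mk (q.1.1 * mk t ^ ((q.2 : ℕ) : ℤ)) : (D.PiTemp ⧸ D.GtpYN 2) ⧸ Z)) ?_
    intro w
    obtain ⟨e, rfl⟩ := QuotientGroup.mk_surjective w
    obtain ⟨y, i, hy, rfl⟩ := hdecE e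
    have h0 : 0 ≤ i % (k.natAbs : ℤ) := Int.emod_nonneg _ hkpos.ne'
    have h1 : i % (k.natAbs : ℤ) < (k.natAbs : ℤ) := Int.emod_lt_of_pos _ hkpos
    refine ⟨(⟨y, hy⟩, ⟨(i % (k.natAbs : ℤ)).toNat, by omega⟩), ?_⟩
    change (QuotientGroup.mk (y * mk t ^ (((i % (k.natAbs : ℤ)).toNat : ℕ) : ℤ)) :
        (D.PiTemp ⧸ D.GtpYN 2) ⧸ Z) = QuotientGroup.mk (y * mk t ^ i)
    rw [Int.toNat_of_nonneg h0, QuotientGroup.eq, mul_inv_rev, mul_assoc, inv_mul_cancel_left,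
      ← zpow_neg, ← zpow_add]
    have hdiv : -(i % (k.natAbs : ℤ)) + i = (k.natAbs : ℤ) * (i / (k.natAbs : ℤ)) := by
      rw [Int.emod_def]
      ring
    rw [hdiv]
    rcases Int.natAbs_eq k with hk | hk
    · rw [← hk, zpow_mul]
      exact Z.zpow_mem (Subgroup.mem_zpowers _) _
    · have hk' : (k.natAbs : ℤ) = -k := by linarith
      rw [hk', show -k * (i / -k) = k * (-(i / -k)) by ring, zpow_mul]
      exact Z.zpow_mem (Subgroup.mem_zpowers _) _
  have hZidx : Z.index ≠ 0 := Subgroup.index_ne_zero_of_finite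
  -- `U := mk⁻¹ Z`: an open normal subgroup of finite index of `Π^tp_X` with `U ∩ Π^tp_Y = Π^tp_{Y₂}`
  let U : OpenNormalSubgroup D.PiTemp :=
    { toSubgroup := Z.comap mk
      isOpen' := Subgroup.isOpen_mono (fun y hy => by
          rw [Subgroup.mem_comap, (hmk_eq_one y).2 hy]
          exact one_mem _) (D.isOpen_GtpYN 2)
      isNormal' := inferInstance }
  have hUfi : U.toSubgroup.FiniteIndex := by
    refine ⟨?_⟩
    change (Z.comap mk).index ≠ 0
    rw [Z.index_comap_of_surjective hmk_surj]
    exact hZidx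
  obtain ⟨V, hV⟩ := D.isProfiniteCompletion_toHat.comap_surjective U hUfi
  -- `[Δ_X, Δ_X]⁻ ≤ V`: commutators of `ι Δ^tp_X` lie in `V` (they die in `E` already), then density
  have hΔV : (⁅D.DeltaHat, D.DeltaHat⁆).topologicalClosure ≤ V.toSubgroup := by
    refine Subgroup.topologicalClosure_minimal _ (Subgroup.commutator_le.2 fun a ha b hb => ?_)
      V.toOpenSubgroup.isClosed
    have hclosed : IsClosed {q : D.PiHat × D.PiHat |
        q.1 * q.2 * q.1⁻¹ * q.2⁻¹ ∈ (V.toSubgroup : Set D.PiHat)} :=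
      V.toOpenSubgroup.isClosed.preimage (by fun_prop)
    have hsub : ((D.DeltaTemp.map D.toHat.toMonoidHom : Subgroup D.PiHat) : Set D.PiHat) ×ˢ
        ((D.DeltaTemp.map D.toHat.toMonoidHom : Subgroup D.PiHat) : Set D.PiHat) ⊆
        {q : D.PiHat × D.PiHat | q.1 * q.2 * q.1⁻¹ * q.2⁻¹ ∈ (V.toSubgroup : Set D.PiHat)} := by
      rintro ⟨_, _⟩ ⟨⟨a', ha', rfl⟩, ⟨b', hb', rfl⟩⟩
      change D.toHat.toMonoidHom a' * D.toHat.toMonoidHom b' * (D.toHat.toMonoidHom a')⁻¹ *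
          (D.toHat.toMonoidHom b')⁻¹ ∈ (V.toSubgroup : Set D.PiHat)
      rw [← map_inv, ← map_inv, ← map_mul, ← map_mul, ← map_mul]
      have hU : a' * b' * a'⁻¹ * b'⁻¹ ∈ U.toSubgroup := by
        change a' * b' * a'⁻¹ * b'⁻¹ ∈ Z.comap mk
        rw [Subgroup.mem_comap, (hmk_eq_one _).2 (D.commutator_mem_GtpYN_two ha' hb')]
        exact one_mem _
      rw [hV] at hU
      exact hU
    have hcl := hclosed.closure_subset_iff.2 hsub
    rw [closure_prod_eq, ← Subgroup.topologicalClosure_coe] at hcl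
    have hab := hcl (Set.mk_mem_prod ha hb)
    rw [commutatorElement_def]
    exact hab
  -- conclude: `x ∈ U ∩ Π^tp_Y = Π^tp_{Y₂}`
  have hxU : x ∈ U.toSubgroup := by
    rw [hV]
    exact Subgroup.mem_comap.2 (hΔV hx)
  change x ∈ Z.comap mk at hxU
  rw [Subgroup.mem_comap] at hxU
  exact (hmk_eq_one x).1 (hZF _ hxU ⟨x, hxY, rfl⟩)


/-! ### `Compat` holds -/

/-- **The §1 hypothesis structure `Compat` holds for every `ThetaSetting`** (all three printed
containments of `EtaleThetaClass.Compat` are consequences of the root data): `Δ_Θ ⊆ (Δ^tp_Y)^Θ`,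
`Δ_Θ ⊆ (Δ^tp_Ÿ)^Θ`, `aug⁻¹(G_K̈) ⊴ Π^tp_X`. [cite: MochizukiEtTh2009, Prop 1.5 p.22] -/
theorem compat : D.Compat :=
  Compat.of_ker_toEll_le_GtpYN D (inf_le_left.trans D.ker_toEll_le_GtpYN_two)

/-- `Π^tp_Ÿ` is normal in `Π^tp_X`, unconditionally (cf. `Compat.GtpYdd_normal`).
[cite: MochizukiEtTh2009, Prop 1.5 (iii) p.23] -/
theorem GtpYdd_normal' : D.GtpYdd.Normal := D.compat.GtpYdd_normal

end ThetaSetting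

end Literature.AnabelianGeometry.EtaleTheta
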